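import Literature.NumberTheory.LFunctions.MertensFirstChainCheck
import HarnessLib

/-!
# Rosser–Schoenfeld's (3.22) by kernel computation: certified run extended, chunks 3–6
# (primes `442439 → 1542283`)

Topic: `Literature/NumberTheory/LFunctions`. Pure proof file (a kernel computation; nothing is asserted, no
definition). Part of the discharge programme of `Literature.NumberTheory.LFunctions.RosserSchoenfeld1962_eq_3_22`
(Rosser–Schoenfeld 1962, Thm. 6 (3.22): `Σ_{p ≤ x} (log p)/p < log x + E + 1/(2 log x)` for `x ≥ 319`). The tree's
certified run `MertensFirstChainRun1/2.lean` reaches the prime `442439`; the three files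
`MertensFirstChainRun3/4/5.lean` (chunks 3–13, `20000` table entries each, primes `442439 → 3605923`) carry the
same chain — each step certifying the next prime, extending the enclosure of `log p`, the majorants of
`Σ_{q ≤ p} (log q)/q` and `Σ_{q ≤ p} (log q)/(q(q−1))`, and performing the comparison `chkM` behind (3.22) at the new
prime — past Dusart's threshold `3 594 641`, so that (3.22) follows for ALL `x ≥ 319` from the tree's named fact
`Dusart2010_theta_thm_5_2` (assembly: `RosserSchoenfeldEq322FromDusart.lean`). The expected states were obtained
by evaluating the same function compiled (`#eval` on the Lean farm, 2026-08-28; all comparisons pass). The meaning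
of the states is `MertensFirstChain.runDM_sound` / `eq_3_22_of_inv` (`MertensFirstChainSound.lean`).
`decide +kernel`, standard axioms only (`maxHeartbeats 0`).

## References
* J. B. Rosser, L. Schoenfeld, Illinois J. Math. 6 (1962), 64–94, Thm. 6 (3.22) and p. 87 (the range below `10⁸`
  by the Rosser–Walker and Appel–Rosser tables). [RosserSchoenfeld1962]
-/

namespace Literature.NumberTheory.LFunctions.MertensFirstChainRun

open MertensFirstChain

set_option maxHeartbeats 0 in
/-- **Chunk 3 of the certified Mertens run** (`20000` steps, primes `442439` to `707753`).
[cite: RosserSchoenfeld1962, Thm. 6 (3.22)] -/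
theorem run3 :
    runDM 20000
      ⟨442439, 15716105628607899312644944, 15716105628608374919620644,
        14107133587455640452304100, 913179468369670269995473⟩ =
    some ⟨707753, 16284049985378910558950670, 16284049985379386166449250,
        14674482244319286400914040, 913180491575140969751040⟩ := by
  decide +kernel

set_option maxHeartbeats 0 in
/-- **Chunk 4 of the certified Mertens run** (`20000` steps, primes `707753` to `980909`).
[cite: RosserSchoenfeld1962, Thm. 6 (3.22)] -/
theorem run4 :
    runDM 20000
      ⟨707753, 16284049985378910558950670, 16284049985379386166449250,
        14674482244319286400914040, 913180491575140969751040⟩ =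
    some ⟨980909, 16678624670827754016832550, 16678624670828229624838610,
        15068659210566873091692538, 913180966853515532885519⟩ := by
  decide +kernel

set_option maxHeartbeats 0 in
/-- **Chunk 5 of the certified Mertens run** (`20000` steps, primes `980909` to `1259143`).
[cite: RosserSchoenfeld1962, Thm. 6 (3.22)] -/
theorem run5 :
    runDM 20000
      ⟨980909, 16678624670827754016832550, 16678624670828229624838610,
        15068659210566873091692538, 913180966853515532885519⟩ =
    some ⟨1259143, 16980501810158157285992846, 16980501810158632894495681,
        15370831621222286556591216, 913181239443455776615002⟩ := by
  decide +kernel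

set_option maxHeartbeats 0 in
/-- **Chunk 6 of the certified Mertens run** (`20000` steps, primes `1259143` to `1542283`).
[cite: RosserSchoenfeld1962, Thm. 6 (3.22)] -/
theorem run6 :
    runDM 20000
      ⟨1259143, 16980501810158157285992846, 16980501810158632894495681,
        15370831621222286556591216, 913181239443455776615002⟩ =
    some ⟨1542283, 17225711202507732003576767, 17225711202508207612567732,
        15615907362811176620046938, 913181415592991498290420⟩ := by
  decide +kernel

end Literature.NumberTheory.LFunctions.MertensFirstChainRun
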